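/-
Copyright (c) 2026. All rights reserved.
Released under Apache 2.0 license as described in the file LICENSE.
Authors: abc-iut cell, statement-typer seat abc-iut-L4-t3 (wave 1; gen 6).
-/
import Literature.AnabelianGeometry.AbsoluteAnabelian.LogFrobeniusIotaOver
import Literature.AnabelianGeometry.AbsoluteAnabelian.LogFrobeniusObservablesMoves
import Literature.AnabelianGeometry.AbsoluteAnabelian.LogFrobeniusMonoGenuineModel
import HarnessLib

/-!
# [AbsTopIII] Def 5.4 (iv)/(vi), Cor 5.5 p. 130 proviso: the space-link and post-log vertices carry ONE functor OVER `Th•[Z]` (interface add-on) — and the `ι⊞` over `Th•[Z]` in component form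

S. Mochizuki, *Topics in absolute anabelian geometry III: global reconstruction algorithms*,
J. Math. Sci. Univ. Tokyo 22 (2015) 939–1156 [MochizukiAbsTopIII2015]; locators `p.N` = pages of the author's
manuscript (`paper:url-5493eb38cbb7`), read on the page (own render): Def 5.4 (iv) pp. 126–127 ("`λ⊞_{v,ν}` … lies over
`Th•[Z]`"), (vi) p. 127, (vii) p. 128 (the `ι⊞_{v,ε}`), Cor 5.5 p. 130 ("subject to the proviso that we identify the functors
associated to the space-link and post-log vertices").

WHY THIS FILE (successor add-on, nothing frozen is edited).  The frozen interface `LogFrobeniusSetting` records the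
proviso of Cor 5.5 p. 130 as the EQUALITY OF FUNCTORS `lam_spaceLink_eq_postLog : λ⊞_{v,space-link} = λ⊞_{v,post-log}`,
but types the "lies over `Th•[Z]`" structure isomorphisms `lamOver v ν` as FREE data per vertex — so the over-structures
at the two identified vertices are NOT identified.  In print the identification is of the vertices' data outright (one
functor, one over-structure).  Consumers meet the gap exactly where the `ι⊞_{v,ε}` along a POST-log edge are pushed down to
`Th•[Z]`: this seat's frozen add-on `IotaOver` (ref-r 8a535c5ed85798f5) pins them with `lamOver v post-log`, while the
diagram `D•⊢` of Cor 5.5 — whose only `λ⊞`-ARROWS are the pre-log ones — reaches the post-log functor through the arrow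
`λ⊞_{v,space-link}` and hence through `lamOver v space-link` (abc-iut-f-102's THEOREM B toolkit,
`LogFrobeniusRealisesOverGenerators`: hypotheses `hpre`/`hpost` with over-data `A := lamOver` at PRE-log vertices).  Here:

* `LamOverLink L : Prop` — ADD-ON LAW: `HEq (lamOver v space-link) (lamOver v post-log)` (the proviso, completed to the
  over-structure); with `LamOverLink.hom_app_heq` / `inv_app_heq`;
* the `ι⊞` over `Th•[Z]` in COMPONENT form, from `IotaOver`: `IotaOver.toE_map_iota_heq_of_preLog`
  (`(𝒩⊞_v → Th•[Z])(ι⊞_{v,ε,X}) ≍ A_{ν₁,X} ∘ A_{ν₂,X}⁻¹`, pre-log `ν₁`), `IotaOver.toE_map_iota_heq_of_postLog`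
  (`≍ A_{ν₁,log X} ∘ Ξ_X ∘ A_{ν₂,X}⁻¹`, post-log `ν₁`, `Ξ := logOver`), and — GIVEN `LamOverLink` —
  `IotaOver.toE_map_iota_heq_spaceLink` (`≍ A_{space-link,log X} ∘ Ξ_X ∘ A_{ν₂,X}⁻¹`): literally abc-iut-f-102's `hpre` /
  `hpost` with `A := fun v ν _ => L.lamOver v ν`, `Ξ := L.logOver`;
* non-vacuity at the GENUINE-component carriers: `archGenuine_lamOverLink`, `nonarchGenuine_lamOverLink`,
  `nonarchGenuineMono_lamOverLink` (there the two over-structures are the same identity).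

Typed-scope hygiene of OUR interface; nothing here bears on [IUTchIII] Cor. 3.12; no side taken; typed ≠ proved.
-/

set_option autoImplicit false

universe u

open CategoryTheory

namespace Literature.AnabelianGeometry.AbsoluteAnabelian

namespace LogFrobeniusSetting

section Law

variable {Vmod : Type u} {isArc : Vmod → Bool} (L : LogFrobeniusSetting Vmod isArc)

/-- **INTERFACE ADD-ON (Cor 5.5 p. 130 proviso, completed): the space-link and post-log vertices carry one functor OVER
`Th•[Z]`** — the structure isomorphisms "`λ⊞_{v,space-link}` lies over `Th•[Z]`" and "`λ⊞_{v,post-log}` lies over `Th•[Z]`"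
coincide (heterogeneously, along the frozen identification `lam_spaceLink_eq_postLog` of the functors).  A hypothesis
schema on `L`, satisfied by print's data. [cite: MochizukiAbsTopIII2015, Cor 5.5 p. 130] -/
def LamOverLink : Prop :=
  ∀ v : Vmod, HEq (L.lamOver v (LogVertex.spaceLink (isArc v))) (L.lamOver v (LogVertex.postLog (isArc v)))

/-- components of heterogeneously equal natural isomorphisms out of equal functors. [folklore] -/
private theorem iso_hom_app_heq {C D : Type*} [Category C] [Category D] {F F' G : C ⥤ D} (hF : F = F')
    {i : F ≅ G} {i' : F' ≅ G} (h : HEq i i') (X : C) : HEq (i.hom.app X) (i'.hom.app X) := by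
  subst hF
  cases h
  rfl

/-- the same for the inverses. [folklore] -/
private theorem iso_inv_app_heq {C D : Type*} [Category C] [Category D] {F F' G : C ⥤ D} (hF : F = F')
    {i : F ≅ G} {i' : F' ≅ G} (h : HEq i i') (X : C) : HEq (i.inv.app X) (i'.inv.app X) := by
  subst hF
  cases h
  rfl

variable {L}

/-- `LamOverLink` componentwise. [cite: MochizukiAbsTopIII2015, Cor 5.5 p. 130] -/
theorem LamOverLink.hom_app_heq (h : L.LamOverLink) (v : Vmod) (X : L.X) :
    HEq ((L.lamOver v (LogVertex.spaceLink (isArc v))).hom.app X)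
      ((L.lamOver v (LogVertex.postLog (isArc v))).hom.app X) :=
  iso_hom_app_heq (by rw [L.lam_spaceLink_eq_postLog v]) (h v) X

/-- `LamOverLink` componentwise, inverses. [cite: MochizukiAbsTopIII2015, Cor 5.5 p. 130] -/
theorem LamOverLink.inv_app_heq (h : L.LamOverLink) (v : Vmod) (X : L.X) :
    HEq ((L.lamOver v (LogVertex.spaceLink (isArc v))).inv.app X)
      ((L.lamOver v (LogVertex.postLog (isArc v))).inv.app X) :=
  iso_inv_app_heq (by rw [L.lam_spaceLink_eq_postLog v]) (h v) X

/-! ### The `ι⊞` over `Th•[Z]`, componentwise -/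

variable (L) in
/-- "`λ⊞_{v,ν} ∘ Λ_ν` lies over `Th•[Z]`" at a PRE-log vertex is "`λ⊞_{v,ν}` lies over" (`Λ_ν = id`).
[cite: MochizukiAbsTopIII2015, Def 5.4 (vii) p. 128] -/
theorem lamTwistOver_hom_app_heq_of_preLog (v : Vmod) (ν : LogVertex (isArc v)) (h : ν.isPostLog = false) (X₀ : L.X) :
    HEq ((L.lamTwistOver v ν).hom.app X₀) ((L.lamOver v ν).hom.app X₀) := by
  unfold lamTwistOver
  generalize ν.isPostLog = b at h ⊢
  subst h
  apply heq_of_eq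
  simp only [Iso.trans_hom, NatTrans.comp_app, Functor.associator_hom_app, Functor.isoWhiskerLeft_hom,
    Functor.whiskerLeft_app, twistOver_false, Functor.leftUnitor_hom_app]
  erw [Category.id_comp, Category.comp_id]
  rfl

variable (L) in
/-- "`λ⊞_{v,ν} ∘ Λ_ν` lies over `Th•[Z]`" at a POST-log vertex is "`λ⊞_{v,ν}` lies over" at `log X` then "`log` lies over".
[cite: MochizukiAbsTopIII2015, Def 5.4 (vii) p. 128] -/
theorem lamTwistOver_hom_app_heq_of_postLog (v : Vmod) (ν : LogVertex (isArc v)) (h : ν.isPostLog = true) (X₀ : L.X) :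
    HEq ((L.lamTwistOver v ν).hom.app X₀) ((L.lamOver v ν).hom.app (L.log.obj X₀) ≫ L.logOver.hom.app X₀) := by
  unfold lamTwistOver
  generalize ν.isPostLog = b at h ⊢
  subst h
  apply heq_of_eq
  simp only [Iso.trans_hom, NatTrans.comp_app, Functor.associator_hom_app, Functor.isoWhiskerLeft_hom,
    Functor.whiskerLeft_app, twistOver_true]
  erw [Category.id_comp]
  rfl

/-- **`ι⊞` over `Th•[Z]` along a PRE-log edge, componentwise** — abc-iut-f-102's `hpre` with `A := lamOver`:
`(𝒩⊞_v → 𝒩_v → Th•[Z])(ι⊞_{v,ε,X}) ≍ A_{ν₁,X} ∘ A_{ν₂,X}⁻¹`. [cite: MochizukiAbsTopIII2015, Def 5.4 (vii) p. 128] -/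
theorem IotaOver.toE_map_iota_heq_of_preLog (hι : L.IotaOver) (v : Vmod) {ν₁ ν₂ : LogVertex (isArc v)}
    (ε : LogEdge (isArc v) ν₁ ν₂) (h₁ : ν₁.isPostLog = false) (X₀ : L.X) :
    HEq ((L.toE v).map ((L.forget v).map ((L.iota v ε).app X₀)))
      ((L.lamOver v ν₁).hom.app X₀ ≫ (L.lamOver v ν₂).inv.app X₀) := by
  rw [hι.app v ε X₀]
  have k : ((frobeniusTwist L.log ν₁.isPostLog ⋙ L.lam v ν₁) ⋙ L.forget v ⋙ L.toE v).obj X₀ =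
      (L.lam v ν₁ ⋙ L.forget v ⋙ L.toE v).obj X₀ := by
    rw [h₁]; rfl
  exact heq_comp k rfl rfl (L.lamTwistOver_hom_app_heq_of_preLog v ν₁ h₁ X₀) HEq.rfl

/-- **`ι⊞` over `Th•[Z]` along a POST-log edge, componentwise**: `≍ A_{ν₁,log X} ∘ Ξ_X ∘ A_{ν₂,X}⁻¹` (`Ξ := logOver`).
[cite: MochizukiAbsTopIII2015, Def 5.4 (vii) p. 128] -/
theorem IotaOver.toE_map_iota_heq_of_postLog (hι : L.IotaOver) (v : Vmod) {ν₁ ν₂ : LogVertex (isArc v)}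
    (ε : LogEdge (isArc v) ν₁ ν₂) (h₁ : ν₁.isPostLog = true) (X₀ : L.X) :
    HEq ((L.toE v).map ((L.forget v).map ((L.iota v ε).app X₀)))
      ((L.lamOver v ν₁).hom.app (L.log.obj X₀) ≫ L.logOver.hom.app X₀ ≫ (L.lamOver v ν₂).inv.app X₀) := by
  rw [hι.app v ε X₀]
  have k : ((frobeniusTwist L.log ν₁.isPostLog ⋙ L.lam v ν₁) ⋙ L.forget v ⋙ L.toE v).obj X₀ =
      (L.lam v ν₁ ⋙ L.forget v ⋙ L.toE v).obj (L.log.obj X₀) := by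
    rw [h₁]; rfl
  refine (heq_comp k rfl rfl (L.lamTwistOver_hom_app_heq_of_postLog v ν₁ h₁ X₀) HEq.rfl).trans ?_
  exact heq_of_eq (Category.assoc _ _ _)

/-- **`ι⊞` over `Th•[Z]` along a POST-log edge, through the SPACE-LINK's over-structure** — abc-iut-f-102's `hpost` with
`A := lamOver` (at pre-log vertices only), `Ξ := logOver` — GIVEN the add-on law `LamOverLink`:
`(𝒩⊞_v → 𝒩_v → Th•[Z])(ι⊞_{v,ε,X}) ≍ A_{space-link, log X} ∘ Ξ_X ∘ A_{ν₂,X}⁻¹`. [cite: MochizukiAbsTopIII2015, Cor 5.5 p. 130] -/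
theorem IotaOver.toE_map_iota_heq_spaceLink (hι : L.IotaOver) (hΛ : L.LamOverLink) (v : Vmod)
    {ν₁ ν₂ : LogVertex (isArc v)} (ε : LogEdge (isArc v) ν₁ ν₂) (h₁ : ν₁.isPostLog = true) (X₀ : L.X) :
    HEq ((L.toE v).map ((L.forget v).map ((L.iota v ε).app X₀)))
      ((L.lamOver v (LogVertex.spaceLink (isArc v))).hom.app (L.log.obj X₀) ≫ L.logOver.hom.app X₀ ≫
        (L.lamOver v ν₂).inv.app X₀) := by
  obtain rfl : ν₁ = LogVertex.postLog (isArc v) := LogVertex.eq_postLog_of_isPostLog _ h₁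
  refine (hι.toE_map_iota_heq_of_postLog v ε h₁ X₀).trans ?_
  have k : (L.lam v (LogVertex.postLog (isArc v)) ⋙ L.forget v ⋙ L.toE v).obj (L.log.obj X₀) =
      (L.lam v (LogVertex.spaceLink (isArc v)) ⋙ L.forget v ⋙ L.toE v).obj (L.log.obj X₀) := by
    rw [L.lam_spaceLink_eq_postLog v]
  exact heq_comp k rfl rfl (hΛ.hom_app_heq v (L.log.obj X₀)).symm HEq.rfl

end Law

/-! ### Non-vacuity at the genuine-component carriers -/

section Arch

variable (𝔄 : AutHolFieldFunctor.{u}) (Vmod : Type (u + 1)) (isArc : Vmod → Bool)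

/-- At the genuine-ARCHIMEDEAN-component setting the two over-structures are the same identity.
[cite: MochizukiAbsTopIII2015, Cor 5.5 p. 130] -/
theorem archGenuine_lamOverLink : (archGenuine 𝔄 Vmod isArc).LamOverLink := by
  intro v
  change HEq (archLamOver 𝔄 (isArc v) (LogVertex.spaceLink (isArc v)))
    (archLamOver 𝔄 (isArc v) (LogVertex.postLog (isArc v)))
  generalize isArc v = b
  cases b <;> exact HEq.rfl

end Arch

section Nonarch

open AbsTopIII

variable (p : ℕ) [Fact p.Prime] (Vmod : Type 1) (isArc : Vmod → Bool)

/-- At the genuine-NONARCHIMEDEAN-component setting the two over-structures are the same identity.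
[cite: MochizukiAbsTopIII2015, Cor 5.5 p. 130] -/
theorem nonarchGenuine_lamOverLink : (nonarchGenuine p Vmod isArc).LamOverLink := by
  intro v
  change HEq (nonarchLamOver p (isArc v) (LogVertex.spaceLink (isArc v)))
    (nonarchLamOver p (isArc v) (LogVertex.postLog (isArc v)))
  generalize isArc v = b
  cases b <;> exact HEq.rfl

/-- At the genuine-nonarchimedean-component setting WITH GENUINE MONO-ANALYTICIZATION the same holds (same `λ⊞` data).
[cite: MochizukiAbsTopIII2015, Cor 5.5 p. 130] -/
theorem nonarchGenuineMono_lamOverLink : (nonarchGenuineMono p Vmod isArc).LamOverLink := by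
  intro v
  change HEq (nonarchLamOver p (isArc v) (LogVertex.spaceLink (isArc v)))
    (nonarchLamOver p (isArc v) (LogVertex.postLog (isArc v)))
  generalize isArc v = b
  cases b <;> exact HEq.rfl

end Nonarch

end LogFrobeniusSetting

end Literature.AnabelianGeometry.AbsoluteAnabelian
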